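import Literature.MathematicalPhysics.QuantumFieldTheory.YangMillsOS
import Literature.MathematicalPhysics.QuantumLattice.GaugeGroupsProofs
import Literature.RepresentationTheory.CompactGroups.UnitaryTrick

/-!
# Crux `IR` (stmt-QuantumFields-19354), line `smallfield-polymer-coder` rev 2: the typed sub-stub
# `stub_oneStepSparseSSM : OneStepSparseSSM` (sparse-defect one-step strong spatial mixing) is FALSE AS TYPED

Q-g18 disprove lineage `ym-19354-disprove-1` (g15); Negative∕ lane of crux `BalabanLadder.IR`, `--supports` only.
Classification **stub-false ∕ misstated (type-level)**: the witness exploits the reconstruction map `recon2`, not the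
physics of spatial mixing.  The crux item's verdict is unchanged, (B) NOT-REFUTED (memo
`pub/ym-beyond/ym-19354-disprove-1/NOT-REFUTED.md` §21): `IR` and every registered load stay `LowerBounds`-guarded.

SOURCE.  `Cruxes/IR/Lines/smallfield_polymer_coder.lean` rev 2 (ideator `ym-ir-idea-4`, mtime 2026-08-28T01:23:59Z,
sha16 `b7bf9647b4548bc9`, 643 lines; a crux workfile, not importable), §3b.  §0 mirrors VERBATIM (up to namespace) the
twelve declarations the stub statement uses, so `not_oneStepSparseSSM` is `¬` the statement of `stub_oneStepSparseSSM`
(:430) up to namespace.  Imports: route-independent Literature modules only.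

THE DEFECT.  `recon2 V φ q := if (q.1 q.2).val % 2 = 0 then V q * (…φ (q.1.shift q.2, q.2)…)⁻¹ else φ q` recomputes the
first link of EVERY 2-line with even starting coordinate from the block field `V` (all `8` parallel lines of a block
per direction), whereas `V = blockField 2 L U` only records the holonomy of the block's CORNER line.  So the window
law `oneStepLaw ρ β δ V τ W P₀` holds the exterior not at `τ` but at `τ̃ := recon2 V τ`, which for a pure gauge `τ`
with a bump off the corner lines is ROUGH: a checked plaquette costs `4 > δ = A/β`, the small-field indicator vanishes
identically, the weight has mass `0` and the normalised law is the junk measure `0`; for `τ' = 1` (same block field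
`V = 1`, same empty defect set) the law is a probability measure.  With `U₀ = ∅` the SSM bound reads
`|P(B) - P'(B)| ≤ 0·K·e^{-R/b} = 0`, and `B = univ` gives `|0 - 1| ≤ 0`.
WITNESS (chosen AFTER the stub's `∃ A K b β₃`).  `G = SU(2)`, `r` fundamental, `rad = 0`, `β = max β₃ (A/4+1)`,
`S = 2` (torus `5⁴`), bump `h(z) = -𝟙` at `z = (1,1,0,0)`, `h = 𝟙` elsewhere, `τ e = h(e.1)·h(e.1+e_{e.2})⁻¹` (flat),
`τ' = V = 1` (`blockField 2 5 τ = 1`: the links it reads have all coordinates `l ≠ i` even), `W = {w_d}`,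
`w_d = ((0,1,0,0), e₀)` (even start: `φ(w_d)` is never read), `U₀ = C = ∅`, `R = 0`, `B = univ`; the checked plaquette
`p⋆ = ((0,1,0,0), e₀∧e₂) ∋ w_d` has `τ̃`-holonomy `-𝟙`, cost `2 - Re tr(-𝟙) = 4`.

REPAIR `C′` (the plainly intended free-link parametrisation of the fibre `{blockField 2 L U = V}`): in `recon2` replace
the test `(q.1 q.2).val % 2 = 0` by «`q` starts its block's corner line», `∀ l, (q.1 l).val % 2 = 0`; then
`recon2' (blockField 2 L U) U = U` on odd tori and this witness misses `C′` (whose truth is research, not addressed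
here).  Sorry-free; axioms `propext`, `Classical.choice`, `Quot.sound`; no `native_decide`.
-/

set_option autoImplicit false

noncomputable section

open Filter Topology MeasureTheory
open scoped ENNReal
open Literature.MathematicalPhysics.QuantumFieldTheory Literature.MathematicalPhysics.QuantumLattice
open Literature.Probability.LatticeModels (Torus.proj Torus.proj_apply)

namespace Summit.QuantumFields.YangMills.Cruxes.IR.SmallFieldPolymerCoderNeg

/-! ## §0 Verbatim mirrors of `Cruxes/IR/Lines/smallfield_polymer_coder.lean` rev 2 (sha16 `b7bf9647b4548bc9`; line numbers `:n`) -/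

section Format

variable {G : Type} [Group G] [TopologicalSpace G] [IsTopologicalGroup G] [CompactSpace G]
  [MeasurableSpace G] [BorelSpace G]

/-- mirror of `SmallFieldPolymerCoder.blockField` (:117): block-holonomy field at block side `M` (seam-exact). -/
def blockField (M N : ℕ) (U : GaugeConfig 4 N G) : GaugeConfig 4 N G := fun q =>
  (((List.range M).filter fun j => M * ((q.1 q.2).val / M) + j < N).map fun j =>
      U (torusEdge N
        ((fun l => ((M * ((q.1 l).val / M) : ℕ) : ℤ)) + Pi.single q.2 (j : ℤ), q.2))).prod

/-- mirror of `SmallFieldPolymerCoder.torusDist` (:306). -/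
def torusDist {L : ℕ} (x y : Literature.MathematicalPhysics.QuantumFieldTheory.Site 4 L) : ℕ :=
  Finset.univ.sup fun l => min (x l - y l).val (y l - x l).val

/-- mirror of `SmallFieldPolymerCoder.plaqCost` (:310). -/
def plaqCost {N L : ℕ} (ρ : G →* Matrix (Fin N) (Fin N) ℂ) (U : GaugeConfig 4 L G) (p : Literature.MathematicalPhysics.QuantumFieldTheory.Plaquette 4 L) : ℝ :=
  (N : ℝ) - (ρ (plaquetteHolonomy U p.1 p.2.1.1 p.2.1.2)).trace.re

/-- mirror of `SmallFieldPolymerCoder.plaqLinks` (:314). -/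
def plaqLinks {L : ℕ} (p : Literature.MathematicalPhysics.QuantumFieldTheory.Plaquette 4 L) : Finset (Literature.MathematicalPhysics.QuantumFieldTheory.Edge 4 L) :=
  {(p.1, p.2.1.1), (p.1.shift p.2.1.1, p.2.1.2), (p.1.shift p.2.1.2, p.2.1.1), (p.1, p.2.1.2)}

/-- mirror of `SmallFieldPolymerCoder.recon2` (:322) — the defective reconstruction (EVERY even-start link from `V`). -/
def recon2 {L : ℕ} (V φ : GaugeConfig 4 L G) : GaugeConfig 4 L G := fun q =>
  if (q.1 q.2).val % 2 = 0 then
    V q * (if (q.1 q.2).val + 1 < L then φ (q.1.shift q.2, q.2) else 1)⁻¹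
  else φ q

/-- mirror of `SmallFieldPolymerCoder.glueCfg` (:328). -/
def glueCfg {L : ℕ} (W : Finset (Literature.MathematicalPhysics.QuantumFieldTheory.Edge 4 L)) (τ φ : GaugeConfig 4 L G) : GaugeConfig 4 L G :=
  fun q => if q ∈ W then φ q else τ q

/-- mirror of `SmallFieldPolymerCoder.oneStepWeight` (:335). -/
def oneStepWeight {N L : ℕ} [NeZero L] (ρ : G →* Matrix (Fin N) (Fin N) ℂ) (β δ : ℝ) (V τ : GaugeConfig 4 L G)
    (W : Finset (Literature.MathematicalPhysics.QuantumFieldTheory.Edge 4 L)) (P₀ : Finset (Literature.MathematicalPhysics.QuantumFieldTheory.Plaquette 4 L)) : Measure (GaugeConfig 4 L G) :=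
  ((Measure.pi fun _ : Literature.MathematicalPhysics.QuantumFieldTheory.Edge 4 L => haarProbability G).withDensity fun φ =>
      ({U : GaugeConfig 4 L G | ∀ p ∈ P₀, plaqCost ρ U p ≤ δ}.indicator 1 (recon2 V (glueCfg W τ φ))) *
        ENNReal.ofReal (Real.exp (-β * wilsonAction ρ (recon2 V (glueCfg W τ φ))))).map
    fun φ => recon2 V (glueCfg W τ φ)

/-- mirror of `SmallFieldPolymerCoder.oneStepLaw` (:343). -/
def oneStepLaw {N L : ℕ} [NeZero L] (ρ : G →* Matrix (Fin N) (Fin N) ℂ) (β δ : ℝ) (V τ : GaugeConfig 4 L G)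
    (W : Finset (Literature.MathematicalPhysics.QuantumFieldTheory.Edge 4 L)) (P₀ : Finset (Literature.MathematicalPhysics.QuantumFieldTheory.Plaquette 4 L)) : Measure (GaugeConfig 4 L G) :=
  (oneStepWeight ρ β δ V τ W P₀ Set.univ)⁻¹ • oneStepWeight ρ β δ V τ W P₀

/-- mirror of `SmallFieldPolymerCoder.checkedPlaqs` (:348). -/
def checkedPlaqs {L : ℕ} [NeZero L] (W : Finset (Literature.MathematicalPhysics.QuantumFieldTheory.Edge 4 L)) (C : Finset (Literature.MathematicalPhysics.QuantumFieldTheory.Site 4 L)) (rad : ℕ) :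
    Finset (Literature.MathematicalPhysics.QuantumFieldTheory.Plaquette 4 L) :=
  Finset.univ.filter fun p => (∃ e ∈ plaqLinks p, e ∈ W) ∧ ∀ c ∈ C, 2 * rad < torusDist p.1 c

/-- mirror of `SmallFieldPolymerCoder.DefectsCoveredBy` (:353). -/
def DefectsCoveredBy {N L : ℕ} (ρ : G →* Matrix (Fin N) (Fin N) ℂ) (δ : ℝ) (rad : ℕ) (C : Finset (Literature.MathematicalPhysics.QuantumFieldTheory.Site 4 L))
    (τ : GaugeConfig 4 L G) : Prop :=
  ∀ p : Literature.MathematicalPhysics.QuantumFieldTheory.Plaquette 4 L, δ < plaqCost ρ τ p → ∃ c ∈ C, torusDist p.1 c ≤ rad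

/-- mirror of `SmallFieldPolymerCoder.Separated` (:358). -/
def Separated {L : ℕ} (ℓ : ℕ) (C : Finset (Literature.MathematicalPhysics.QuantumFieldTheory.Site 4 L)) : Prop :=
  ∀ c ∈ C, ∀ c' ∈ C, c ≠ c' → ℓ ≤ torusDist c c'

end Format

/-- mirror of `SmallFieldPolymerCoder.OneStepSparseSSM` (:374) — the statement of `stub_oneStepSparseSSM` (:430),
verbatim. -/
def OneStepSparseSSM : Prop :=
  ∀ (G : Type) [Group G] [TopologicalSpace G] [IsTopologicalGroup G] [CompactSpace G],
    IsCompactSimpleLieGroup G →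
    letI : MeasurableSpace G := borel G
    haveI : BorelSpace G := ⟨rfl⟩
    ∀ (r : LatticeRep G) (rad : ℕ), ∃ (A K : ℝ) (b : ℕ) (β₃ : ℝ), 0 < A ∧ 1 ≤ b ∧
      ∀ β : ℝ, β₃ ≤ β → ∀ (S : ℕ) (W U₀ : Finset (Literature.MathematicalPhysics.QuantumFieldTheory.Edge 4 (2 * S + 1))) (C : Finset (Literature.MathematicalPhysics.QuantumFieldTheory.Site 4 (2 * S + 1)))
        (V τ τ' : GaugeConfig 4 (2 * S + 1) G),
        U₀ ⊆ W → Separated b C →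
        blockField 2 (2 * S + 1) τ = V → blockField 2 (2 * S + 1) τ' = V →
        DefectsCoveredBy r.ρ (A / (2 * β)) rad C τ → DefectsCoveredBy r.ρ (A / (2 * β)) rad C τ' →
        ∀ R : ℕ, (∀ q : Literature.MathematicalPhysics.QuantumFieldTheory.Edge 4 (2 * S + 1), q ∉ W → τ q ≠ τ' q → ∀ u ∈ U₀, R ≤ torusDist q.1 u.1) →
        ∀ B : Set (GaugeConfig 4 (2 * S + 1) G), MeasurableSet B →
          DependsOn (fun U : GaugeConfig 4 (2 * S + 1) G => U ∈ B) (↑U₀ : Set (Literature.MathematicalPhysics.QuantumFieldTheory.Edge 4 (2 * S + 1))) →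
          |(oneStepLaw r.ρ β (A / β) V τ W (checkedPlaqs W C rad) B).toReal -
              (oneStepLaw r.ρ β (A / β) V τ' W (checkedPlaqs W C rad) B).toReal| ≤
            (U₀.card : ℝ) * K * Real.exp (-(R : ℝ) / b)

/-! ## §1 Generic facts about the mirrored objects -/
section Generic

variable {G : Type} [Group G]

/-- The block field of the trivial configuration is trivial. -/
theorem blockField_one (M N : ℕ) : blockField M N (fun _ => (1 : G)) = fun _ => 1 := by
  funext q
  unfold blockField
  apply List.prod_eq_one
  intro g hg
  rw [List.mem_map] at hg
  obtain ⟨j, _, rfl⟩ := hg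
  rfl

/-- `recon2 1 1 = 1`. -/
theorem recon2_one_one (L : ℕ) :
    recon2 (fun _ => (1 : G)) (fun _ : Literature.MathematicalPhysics.QuantumFieldTheory.Edge 4 L => (1 : G)) =
      fun _ => 1 := by
  funext q
  unfold recon2
  split_ifs <;> simp

/-- The trivial configuration is flat: every plaquette holonomy is `1`. -/
theorem plaquetteHolonomy_one {L : ℕ} (x : Literature.MathematicalPhysics.QuantumFieldTheory.Site 4 L) (i j : Fin 4) :
    plaquetteHolonomy (fun _ : Literature.MathematicalPhysics.QuantumFieldTheory.Edge 4 L => (1 : G)) x i j = 1 := by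
  simp [plaquetteHolonomy]

/-- A flat configuration has no large plaquettes, so the EMPTY defect set covers them at every positive threshold. -/
theorem defectsCoveredBy_empty_of_flat {N L : ℕ} (ρ : G →* Matrix (Fin N) (Fin N) ℂ) {δ : ℝ} (rad : ℕ)
    {U : GaugeConfig 4 L G} (hU : ∀ p, plaqCost ρ U p = 0) (hδ : 0 < δ) :
    DefectsCoveredBy ρ δ rad ∅ U := by
  intro p hp
  rw [hU p] at hp
  exact absurd hp (not_lt.mpr hδ.le)

end Generic

/-! ## §2 The witness: `SU(2)`, the `5⁴` torus, a pure gauge with a bump off the corner lines -/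

local notation "Site5" => Literature.MathematicalPhysics.QuantumFieldTheory.Site 4 (2 * 2 + 1)
local notation "Edge5" => Literature.MathematicalPhysics.QuantumFieldTheory.Edge 4 (2 * 2 + 1)
local notation "Plaq5" => Literature.MathematicalPhysics.QuantumFieldTheory.Plaquette 4 (2 * 2 + 1)
/-- `SU(2)`. -/
abbrev SU2 : Type := Matrix.specialUnitaryGroup (Fin 2) ℂ

/-- The fundamental representation of `SU(2)` as lattice representation data. -/
def rSU2 : LatticeRep SU2 :=
  ⟨2, fundamentalRep (Fin 2), continuous_fundamentalRep _, fundamentalRep_injective _, fundamentalRep_mem_unitaryGroup⟩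

/-- The central element `-𝟙 ∈ SU(2)`. -/
def gneg : SU2 := ⟨-1, by
  rw [Matrix.mem_specialUnitaryGroup_iff]
  exact ⟨by rw [Matrix.mem_unitaryGroup_iff]; simp, by simp [Matrix.det_neg, Fintype.card_fin]⟩⟩

/-- `Re tr ρ((-𝟙)⁻¹) = -2`, so the cost of a plaquette with holonomy `(-𝟙)⁻¹` is `4`. -/
theorem trace_re_gneg_inv : ((fundamentalRep (Fin 2)) (gneg⁻¹)).trace.re = -2 := by
  have hc : ((gneg⁻¹ : SU2) : Matrix (Fin 2) (Fin 2) ℂ) = -1 := by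
    rw [← Matrix.star_eq_inv]
    change star (gneg : Matrix (Fin 2) (Fin 2) ℂ) = -1
    simp [gneg]
  rw [fundamentalRep_apply, hc, Matrix.trace_neg, Matrix.trace_one, Fintype.card_fin]
  simp

/-- The bump site `z = (1,1,0,0)`. -/
def z : Site5 := ![1, 1, 0, 0]
/-- The base point `x⋆ = (0,1,0,0)` of the even-start window link and of the checked plaquette. -/
def xStar : Site5 := ![0, 1, 0, 0]

/-- The gauge function: `-𝟙` at `z`, `𝟙` elsewhere. -/
def hfun (y : Site5) : SU2 := if y = z then gneg else 1

/-- The exterior configuration `τ = (pure gauge of h) = h(x) h(x + eᵢ)⁻¹` (flat). -/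
def tau : GaugeConfig 4 (2 * 2 + 1) SU2 := fun e => hfun e.1 * (hfun (e.1.shift e.2))⁻¹

/-- The window link `w_d = (x⋆, e₀)` (even starting coordinate: a DETERMINED link of `recon2`). -/
def wd : Edge5 := (xStar, 0)
/-- The checked plaquette `p⋆ = (x⋆, e₀ ∧ e₂)`. -/
def pStar : Plaq5 := (xStar, ⟨((0 : Fin 4), (2 : Fin 4)), by decide⟩)

/-- Site arithmetic on the `5⁴` torus along the boundary of `p⋆` (closed decidable facts, used by `simp`). -/
private theorem wfacts :
    xStar.shift 0 = z ∧ z.shift 0 ≠ z ∧ z.shift 2 ≠ z ∧ (z.shift 2).shift 2 ≠ z ∧ (xStar.shift 2).shift 0 ≠ z ∧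
      ((xStar.shift 2).shift 0).shift 0 ≠ z ∧ xStar.shift 2 ≠ z ∧ (xStar.shift 2).shift 2 ≠ z ∧
      (xStar 0).val = 0 ∧ (z 2).val = 0 ∧ ((xStar.shift 2) 0).val = 0 ∧ (xStar 2).val = 0 := by
  decide
/-- `((2m : ℕ) : ℤ/5) ≠ 1` for `m ≤ 2`. -/
private theorem two_mul_cast_ne_one (m : ℕ) (hm : m ≤ 2) : ((2 * m : ℕ) : ZMod (2 * 2 + 1)) ≠ 1 := by
  interval_cases m <;> decide

/-- The links read by `blockField 2 5` (corner lines: all coordinates `l ≠ i` in `{0,2,4}`) and their `i`-shifts avoid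
the bump site `z` (whose coordinates `0, 1` are both `1`), whatever the offset `j` along the line. -/
theorem cornerLine_avoids_z (q : Edge5) (j : ℤ) :
    Torus.proj (2 * 2 + 1) ((fun l => ((2 * ((q.1 l).val / 2) : ℕ) : ℤ)) + Pi.single q.2 j) ≠ z ∧
      Site.shift (L := 2 * 2 + 1)
          (Torus.proj (2 * 2 + 1) ((fun l => ((2 * ((q.1 l).val / 2) : ℕ) : ℤ)) + Pi.single q.2 j)) q.2 ≠ z := by
  obtain ⟨l₀, hl₀, hzl₀⟩ : ∃ l₀ : Fin 4, l₀ ≠ q.2 ∧ z l₀ = 1 := by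
    by_cases h : q.2 = 0
    · exact ⟨1, by rw [h]; decide, by decide⟩
    · exact ⟨0, fun h' => h h'.symm, by decide⟩
  have hm : (q.1 l₀).val / 2 ≤ 2 := by
    have := ZMod.val_lt (q.1 l₀)
    omega
  have hne := two_mul_cast_ne_one _ hm
  have hv0 : Torus.proj (2 * 2 + 1) ((fun l => ((2 * ((q.1 l).val / 2) : ℕ) : ℤ)) + Pi.single q.2 j) l₀ =
      ((2 * ((q.1 l₀).val / 2) : ℕ) : ZMod (2 * 2 + 1)) := by
    rw [Torus.proj_apply, Pi.add_apply, Pi.single_eq_of_ne hl₀, add_zero, Int.cast_natCast]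
  refine ⟨fun h => hne ?_, fun h => hne ?_⟩
  · rw [← hv0, h, hzl₀]
  · have := congr_fun h l₀
    simp only [Site.shift, Pi.add_apply, Pi.single_eq_of_ne hl₀, add_zero] at this
    rw [hv0] at this
    rw [this, hzl₀]

/-- `τ` is trivial on a (lifted) link whose endpoints avoid `z`. -/
theorem tau_torusEdge_eq_one (y : Fin 4 → ℤ) (i : Fin 4) (h1 : Torus.proj (2 * 2 + 1) y ≠ z)
    (h2 : Site.shift (L := 2 * 2 + 1) (Torus.proj (2 * 2 + 1) y) i ≠ z) :
    tau (torusEdge (2 * 2 + 1) (y, i)) = 1 := by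
  simp [tau, hfun, torusEdge, h1, h2]

/-- **The bump is invisible to the block field**: `blockField 2 5 τ = 1`. -/
theorem blockField_tau : blockField 2 (2 * 2 + 1) tau = fun _ => 1 := by
  funext q
  unfold blockField
  apply List.prod_eq_one
  intro g hg
  rw [List.mem_map] at hg
  obtain ⟨j, _, rfl⟩ := hg
  obtain ⟨h1, h2⟩ := cornerLine_avoids_z q j
  exact tau_torusEdge_eq_one _ _ h1 h2

/-- `τ` is flat (a pure gauge). -/
theorem plaquetteHolonomy_tau (x : Site5) (i j : Fin 4) : plaquetteHolonomy tau x i j = 1 := by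
  have hshift : (x.shift j).shift i = (x.shift i).shift j := by
    simp only [Site.shift, add_assoc, add_comm (Pi.single (M := fun _ => ZMod (2 * 2 + 1)) j 1)]
  simp only [plaquetteHolonomy, tau, hshift, mul_inv_rev, inv_inv]
  group

/-- A plaquette with trivial holonomy costs nothing (fundamental `SU(2)`: `2 - Re tr 𝟙 = 0`). -/
theorem plaqCost_eq_zero_of_holonomy {U : GaugeConfig 4 (2 * 2 + 1) SU2} (p : Plaq5)
    (h : plaquetteHolonomy U p.1 p.2.1.1 p.2.1.2 = 1) : plaqCost rSU2.ρ U p = 0 := by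
  show ((2 : ℕ) : ℝ) - ((fundamentalRep (Fin 2)) (plaquetteHolonomy U p.1 p.2.1.1 p.2.1.2)).trace.re = 0
  rw [h, MonoidHom.map_one, Matrix.trace_one, Fintype.card_fin]
  simp

/-- An even-start link's successor along its own direction is never the window link `w_d` (unless the line is
truncated). -/
theorem shift_ne_wd (x : Site5) (i : Fin 4) (hlt : (x i).val + 1 < 2 * 2 + 1) : (x.shift i, i) ≠ wd := by
  intro h
  simp only [wd, Prod.mk.injEq] at h
  obtain ⟨hx, hi⟩ := h
  subst hi
  have h0 := congr_fun hx 0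
  rw [Site.shift, Pi.add_apply, Pi.single_eq_same, show xStar 0 = 0 from by decide] at h0
  have hx4 : x 0 = 4 := by rw [eq_neg_of_add_eq_zero_left h0]; decide
  rw [hx4] at hlt
  revert hlt
  decide

/-- **`φ(w_d)` is never read**: with the window `{w_d}` the reconstructed configuration does not depend on the
resampled link at all (it is a determined link, recomputed from `V`). -/
theorem recon2_glue_wd (V τ φ : GaugeConfig 4 (2 * 2 + 1) SU2) : recon2 V (glueCfg {wd} τ φ) = recon2 V τ := by
  funext q
  obtain ⟨x, i⟩ := q
  simp only [recon2, glueCfg, Finset.mem_singleton]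
  by_cases hpar : (x i).val % 2 = 0
  · by_cases hlt : (x i).val + 1 < 2 * 2 + 1
    · simp [hpar, hlt, shift_ne_wd x i hlt]
    · simp [hpar, hlt]
  · have hne : (x, i) ≠ wd := by
      intro h
      simp only [wd, Prod.mk.injEq] at h
      obtain ⟨hx, hi⟩ := h
      subst hx hi
      exact hpar (by rw [wfacts.2.2.2.2.2.2.2.2.1])
    simp [hpar, hne]

/-- **The held exterior `τ̃ = recon2 1 τ` is rough at `p⋆`**: holonomy `-𝟙`. -/
theorem plaquetteHolonomy_recon2_tau : plaquetteHolonomy (recon2 (fun _ => (1 : SU2)) tau) xStar 0 2 = gneg⁻¹ := by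
  simp [plaquetteHolonomy, recon2, tau, hfun, wfacts]

/-- … so `p⋆` costs `4` in `τ̃`. -/
theorem plaqCost_recon2_tau : plaqCost rSU2.ρ (recon2 (fun _ => (1 : SU2)) tau) pStar = 4 := by
  show ((2 : ℕ) : ℝ) - ((fundamentalRep (Fin 2)) (plaquetteHolonomy (recon2 (fun _ => (1 : SU2)) tau) xStar 0 2)).trace.re = 4
  rw [plaquetteHolonomy_recon2_tau, trace_re_gneg_inv]
  norm_num

/-- The window link is a link of the checked plaquette. -/
theorem wd_mem_plaqLinks : wd ∈ plaqLinks pStar := by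
  unfold plaqLinks pStar wd
  exact Finset.mem_insert_self _ _

/-- **Mass zero for `τ`**: the small-field indicator vanishes identically (the held exterior `τ̃` violates it at `p⋆`). -/
theorem oneStepWeight_tau (β δ : ℝ) (hδ : δ < 4) (rad : ℕ) :
    oneStepWeight rSU2.ρ β δ (fun _ => 1) tau {wd} (checkedPlaqs {wd} ∅ rad) = 0 := by
  have hnot : recon2 (fun _ => (1 : SU2)) tau ∉
      {U : GaugeConfig 4 (2 * 2 + 1) SU2 | ∀ p ∈ checkedPlaqs {wd} ∅ rad, plaqCost rSU2.ρ U p ≤ δ} := by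
    intro hU
    have h4 : plaqCost rSU2.ρ (recon2 (fun _ => (1 : SU2)) tau) pStar ≤ δ := by
      apply hU pStar
      simp only [checkedPlaqs, Finset.mem_filter, Finset.mem_univ, true_and]
      exact ⟨⟨wd, wd_mem_plaqLinks, Finset.mem_singleton_self _⟩, fun c hc => absurd hc (Finset.notMem_empty c)⟩
    rw [plaqCost_recon2_tau] at h4
    linarith
  unfold oneStepWeight
  simp only [recon2_glue_wd, Set.indicator_of_notMem hnot, zero_mul]
  rw [show (fun _ : GaugeConfig 4 (2 * 2 + 1) SU2 => (0 : ℝ≥0∞)) = 0 from rfl, withDensity_zero, Measure.map_zero]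

/-- … hence the normalised window law for `τ` is the junk measure `0`. -/
theorem oneStepLaw_tau (β δ : ℝ) (hδ : δ < 4) (rad : ℕ) :
    oneStepLaw rSU2.ρ β δ (fun _ => 1) tau {wd} (checkedPlaqs {wd} ∅ rad) = 0 := by
  unfold oneStepLaw
  rw [oneStepWeight_tau β δ hδ rad, smul_zero]

/-- **Mass one for `τ' = 1`**: the normalised law is a probability measure. -/
theorem oneStepLaw_one_univ (β δ : ℝ) (hδ : 0 ≤ δ) (rad : ℕ) :
    oneStepLaw rSU2.ρ β δ (fun _ => 1) (fun _ => 1) {wd} (checkedPlaqs {wd} ∅ rad) Set.univ = 1 := by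
  haveI : IsProbabilityMeasure (haarProbability SU2) :=
    Literature.RepresentationTheory.CompactGroups.CompactGroup.isProbabilityMeasure_haarMeasure_top
  have hmem : (fun _ : Edge5 => (1 : SU2)) ∈
      {U : GaugeConfig 4 (2 * 2 + 1) SU2 | ∀ p ∈ checkedPlaqs {wd} ∅ rad, plaqCost rSU2.ρ U p ≤ δ} := by
    intro p _
    rw [plaqCost_eq_zero_of_holonomy p (plaquetteHolonomy_one _ _ _)]
    exact hδ
  set c : ℝ≥0∞ := ENNReal.ofReal (Real.exp (-β * wilsonAction rSU2.ρ (fun _ : Edge5 => (1 : SU2)))) with hc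
  have hc0 : c ≠ 0 := (ENNReal.ofReal_pos.mpr (Real.exp_pos _)).ne'
  have hctop : c ≠ ⊤ := ENNReal.ofReal_ne_top
  have hw : oneStepWeight rSU2.ρ β δ (fun _ => 1) (fun _ => 1) {wd} (checkedPlaqs {wd} ∅ rad) Set.univ = c := by
    unfold oneStepWeight
    simp only [recon2_glue_wd, recon2_one_one, Set.indicator_of_mem hmem, Pi.one_apply, one_mul]
    rw [Measure.map_apply measurable_const MeasurableSet.univ, Set.preimage_univ,
      withDensity_apply _ MeasurableSet.univ, Measure.restrict_univ, lintegral_const, measure_univ, mul_one]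
  unfold oneStepLaw
  rw [Measure.smul_apply, hw, smul_eq_mul, ENNReal.inv_mul_cancel hc0 hctop]

/-! ## §3 The refutation -/

/-- **`OneStepSparseSSM` (the statement of `stub_oneStepSparseSSM`, line `smallfield-polymer-coder` rev 2) is false.**
Classification: stub-false ∕ MISSTATED (type-level) — `recon2` recomputes every even-start link from the block field, so
the «exterior held at `τ`» is held at the rough `recon2 V τ` instead; witness `SU(2)`, `5⁴` torus, pure gauge with a bump
at `(1,1,0,0)` vs `1`, window = one even-start link, `U₀ = C = ∅`, `R = 0`, `B = univ`: `|0 - 1| ≤ 0`.  Repair `C′`: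
determine only the corner line's first link in `recon2` (`∀ l, (q.1 l).val % 2 = 0`); the witness misses `C′`. -/
theorem not_oneStepSparseSSM : ¬ OneStepSparseSSM := by
  intro h
  have hG : IsCompactSimpleLieGroup SU2 :=
    isCompactSimpleLieGroup_specialUnitaryGroup isSimpleCompactGroup_specialUnitaryGroup_holds le_rfl
  letI : MeasurableSpace SU2 := borel _
  haveI : BorelSpace SU2 := ⟨rfl⟩
  obtain ⟨A, K, b, β₃, hA, -, hmain⟩ := h SU2 hG rSU2 0
  set β : ℝ := max β₃ (A / 4 + 1)
  have hβ₃ : β₃ ≤ β := le_max_left _ _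
  have hβpos : 0 < β := lt_of_lt_of_le (by linarith) (le_max_right β₃ (A / 4 + 1))
  have hAβ : A / β < 4 := by rw [div_lt_iff₀ hβpos]; linarith [le_max_right β₃ (A / 4 + 1)]
  have hAβ' : 0 ≤ A / β := (div_pos hA hβpos).le
  have hA2β : 0 < A / (2 * β) := div_pos hA (by linarith)
  have key := hmain β hβ₃ 2 {wd} ∅ ∅ (fun _ => 1) tau (fun _ => 1) (Finset.empty_subset _)
    (by intro c hc; simp at hc) blockField_tau (blockField_one 2 (2 * 2 + 1))
    (defectsCoveredBy_empty_of_flat rSU2.ρ 0 (fun p => plaqCost_eq_zero_of_holonomy p (plaquetteHolonomy_tau _ _ _)) hA2β)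
    (defectsCoveredBy_empty_of_flat rSU2.ρ 0 (fun p => plaqCost_eq_zero_of_holonomy p (plaquetteHolonomy_one _ _ _)) hA2β)
    0 (by intro q _ _ u hu; simp at hu) Set.univ MeasurableSet.univ (by intro U U' _; simp)
  rw [oneStepLaw_tau β (A / β) hAβ 0, oneStepLaw_one_univ β (A / β) hAβ' 0] at key
  norm_num at key

end Summit.QuantumFields.YangMills.Cruxes.IR.SmallFieldPolymerCoderNeg

end
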